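import Literature.AlgebraicGeometry.Motives.HodgeStructureLefschetzGroupInvariantsRational
import Literature.AlgebraicGeometry.Motives.HodgeStructureExteriorPowerHodgeGroup
import Literature.AlgebraicGeometry.Motives.HodgeStructureExteriorPowerDivisorClasses
import Literature.AlgebraicGeometry.Motives.HodgeStructureEndAlgMumfordTateCommutant
import Literature.AlgebraicGeometry.Motives.HodgeStructureCentralizerEquivariantFormsPoints
import Literature.AlgebraicGeometry.Motives.HodgeStructureCentralizerEquivariantForms
import Literature.AlgebraicGeometry.Motives.HodgeTensorFactsHolds
import HarnessLib

/-!
# Milne 1999 §4, "Lefschetz classes and Hodge classes", on the abstract polarized `ℚ`-Hodge structure of odd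
# weight: the divisor `2`-vectors ARE the Hodge classes of `⋀² H` (Lefschetz `(1,1)` on the carrier),
# `D(A) ⊂ H(A)`, Cor. 4.5 `H^{2p}(A, ℚ)^{S(A)} = Dᵖ(A)`, and `Hg′(A) = S(A) ⟹` no exotic Hodge classes

[topic AlgebraicGeometry/Motives]

Layer `Literature/AlgebraicGeometry/Motives`, lane `lit-hodgefound` (Track 2 foundations library; seat `lit-hodgefound-p34`,
generation 26, self-proposed row g26-#1 of `run/shared/lean/pub/lit-hodgefound/SKELETON.md`). THEOREMS ONLY (no definition,
no named fact; net debt `0`). CARRIER: a pure `ℚ`-Hodge structure `H` of weight `n` on `V` with a polarization `Q`, the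
exterior algebra `⋀_ℚ V ⊇ ⋀[ℚ]^k V`, p02's extension of scalars `Θ = toComplexAlg V : ⋀_ℚ V →ₐ ⋀_ℂ (ℂ ⊗ V)`, Milne's group
through its `ℂ`-points `S(H)(ℂ) = Q.lefschetzGroupBaseChange ℂ` (g18-#1), the Hodge group `Hg(H)(ℂ) = H.hodgeGroupBaseChange ℂ`,
p02's Hodge structure `H.exteriorPower k` on `⋀ᵏ V` with its Hodge classes `Bᵖ = (H.exteriorPower (2p)).hodgeClasses (p n)`
(type `(pn, pn)`), and p29's divisor classes `H.divisorClasses p ⊆ ⋀^{2p} V` (`D⁰ = ⋀⁰`, `D^{p+1} = Dᵖ ∧ B¹`, Lange's `D•`).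
This file JOINS the seat's Milne-§3 line (g25-#6 `…LefschetzGroupInvariantsRational`: the rational `S(H)`-invariants are
`(span_ℚ D_ℚ)ᵖ`, `D_ℚ` the rational divisor `2`-vectors) to the Hodge-classes line (p40/p02 `…ExteriorPowerHodgeGroup`:
Thm. 7.2.4 `Bᵖ = (⋀^{2p} V)^{Hg}`; p29 `…ExteriorPowerDivisorClasses`).

## The source, verbatim

J. S. Milne, *Lefschetz classes on abelian varieties*, Duke Math. J. **96** (1999) 639–675 [Milne1999LefschetzClasses] (held
`paper:doi-10-1215-s0012-7094-99-09620-5`; PDF page = printed page − 638). p0021 L24–L27 (p. 659): "**Corollary 4.5.** For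
any abelian variety `A` and any `r ≥ 0`, `H^{2*}(A^r)(*)^{L(A)} = D_hom(A^r)_k`. Proof. In the last proof, it was noted that
the statement becomes true when `L(A)` is replaced with `G(A)`." and L28–L30 "the kernel of `l(A)`, regarded as a subgroup of
`GL(V(A))`, equals `S(A)`." p0022 L20–L35 (p. 660): "**Application: Lefschetz classes and Hodge classes.** A Hodge class on
an abelian variety `A` over `ℂ` is an element of type `(0, 0)` in `H_B^{2s}(A)(s)` for some `s`. The Hodge classes on `A`
form a `ℚ`-subalgebra `H(A)` of `H_B^{2*}(A)(*)`. The Hodge group `Hg(A)` of `A` is defined to be the largest algebraic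
subgroup of `GL(V_B(A)) × 𝔾_m` fixing all the Hodge classes on `A` and its powers. It has the property that
`H^{2*}(A^r)(*)^{Hg(A)} = H(A^r)` for all `r` (Deligne 1982, proof of Proposition 3.4). […] Clearly `D_hom(A) ⊂ H(A)`, and
so `L(A) ⊃ Hg(A)`. A Hodge class not in `D_hom(A)` will be said to be *exotic*. **Proposition 4.8.** The following
conditions on an abelian variety `A` are equivalent: (a) no power of `A` supports an exotic Hodge class; (b) `Hg(A) = L(A)`;
(c) `Hg′(A) = S(A)`; Proof. The groups `Hg(A)` and `L(A)` are the largest algebraic subgroups of `GL(H¹(A)) × 𝔾_m` fixing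
respectively the Hodge classes and the Lefschetz classes on the powers of `A`, and conversely, these are precisely the
classes fixed by the two groups." p0023 L1–L2 (p. 661): "The class `c` is fixed by the identity component of `S(A)` but
not by `S(A)` itself." D. Mumford, *Abelian varieties* (1970) [MumfordAV1970] §21 Application III p. 208:
`NS(A) ⊗ ℚ ≅ {a ∈ End⁰(A) | a† = a}`; with Lefschetz's theorem on `(1,1)`-classes this reads
`H²(A, ℚ) ∩ H^{1,1} = {e_D} = {E(a ·, ·) : a† = a}`. H. Lange, *Abelian Varieties over the Complex Numbers* (2023)
[Lange2023AbelianVarietiesComplex] §7.3.1: "`D•` the subring of `H^{2•}_Hodge` generated by `H⁰_Hodge` and `H²_Hodge`".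

## What is PROVED (`Θ = toComplexAlg V`; `D_ℚ = {y ∈ ⋀[ℚ]^2 V | ∃ a ∈ E_φ, a† = a, ψ_y = Q(a ·, ·)}` as in g25-#6, where
`ψ_y(v, w) = B_y(Q(v, ·), Q(w, ·))`; `Bᵖ = (H.exteriorPower (2p)).hodgeClasses (p n)`, `Dᵖ = H.divisorClasses p`)

* §0 BRIDGE `Θ` ↔ `θ₀`: `coe_exteriorPower_map_exteriorPowerBaseChangeEquiv_ofRat` (`⋀ᵏγ (θ₀(1 ⊗ x)) = ⋀(γ)(Θ x)` in
  `⋀_ℂ V_ℂ`), `exteriorPower_map_exteriorPowerBaseChangeEquiv_ofRat_eq_iff` (fixed in `⋀ᵏ_ℂ` iff fixed in `⋀_ℂ`).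
* §1 "`H^{2*}(A)^{Hg(A)} = H(A)`" AND "`D(A) ⊂ H(A)`":
  `mem_hodgeClasses_exteriorPower_iff_forall_hodgeGroupBaseChange_map_toComplexAlg_eq` (Thm. 7.2.4 of the tree in the
  `Θ`-language: `x ∈ Bᵖ` iff `Θ x` is fixed by `Hg(H)(ℂ)`, `p + p = k n`),
  **`Polarization.mem_hodgeClasses_of_forall_lefschetzGroupBaseChange_map_toComplexAlg_eq`** (a rational class whose
  complexification is fixed by `S(H)(ℂ) ⊇ Hg(H)(ℂ)` is a Hodge class — any weight),
  `Polarization.span_divisorTwoVectors_pow_le_map_hodgeClasses` (`(span_ℚ D_ℚ)ᵖ ⊆ Bᵖ`, odd weight).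
* §2 LEFSCHETZ `(1,1)` ON THE CARRIER: `Polarization.exists_mem_endAlg_forall_contractionForm_apply_eq_of_mem_hodgeClasses`
  (a Hodge class `y ∈ ⋀² V` of type `(n, n)` has `ψ_y = Q(a ·, ·)` with `a ∈ E_φ` — any weight),
  `Polarization.adjoint_eq_self_of_forall_contractionForm_apply_eq` (then `a† = a`, odd weight),
  **`Polarization.mem_hodgeClasses_two_iff_exists_mem_endAlg`** (`y ∈ B¹ ⟺ ∃ a ∈ E_φ, a† = a, ψ_y = Q(a ·, ·)`:
  "`H² ∩ H^{n,n} = NS ⊗ ℚ = {E(a ·, ·) : a† = a}`"), **`Polarization.divisorTwoVectors_eq_image_hodgeClasses`**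
  (`D_ℚ = B¹` inside `⋀_ℚ V`), `Polarization.span_divisorTwoVectors_eq_map_hodgeClasses` (`span_ℚ D_ℚ = B¹`).
* §3 MILNE'S `D(A)` IS LANGE'S `D•`: **`Polarization.span_divisorTwoVectors_pow_eq_map_divisorClasses`**
  (`(span_ℚ D_ℚ)ᵖ = Dᵖ` inside `⋀_ℚ V`).
* §4 COR. 4.5 ON THE CARRIER (`r = 1`, `k = ℚ`):
  **`Polarization.forall_lefschetzGroupBaseChange_map_toComplexAlg_eq_iff_mem_divisorClasses`** (for `x ∈ ⋀^{2p}_ℚ V`: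
  `Θ x` is fixed by `S(H)(ℂ)` iff `x ∈ Dᵖ`), the set form
  `Polarization.setOf_mem_and_forall_lefschetzGroupBaseChange_map_toComplexAlg_eq_eq_map_divisorClasses`
  ("`H^{2p}(A, ℚ)^{S(A)} = Dᵖ(A)`"), the whole algebra
  `Polarization.setOf_forall_lefschetzGroupBaseChange_map_toComplexAlg_eq_eq_adjoin_hodgeClasses_two`
  ("`H^{2*}(A)^{S(A)} = ℚ[B¹]`"), and the exotic classes: `Polarization.not_mem_divisorClasses_iff_of_mem_hodgeClasses`
  (a Hodge class is exotic iff some `γ ∈ S(H)(ℂ)` moves it).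
* §5 PROP. 4.8 (c) ⟹ (a) FOR `A` ITSELF: **`Polarization.divisorClasses_eq_hodgeClasses_of_hodgeGroupBaseChange_eq`**
  (`Hg(H)(ℂ) = S(H)(ℂ) ⟹ Dᵖ = Bᵖ` for every `p`: no exotic Hodge classes), and the converse on `A` read pointwise
  `Polarization.forall_lefschetzGroupBaseChange_map_toComplexAlg_eq_of_forall_divisorClasses_eq` (`Dᵖ = Bᵖ` for all `p`
  ⟹ every Hodge class of `⋀^{2•} H` is fixed by `S(H)(ℂ)`).

## Lean encoding, differences

"Fixed by the algebraic group over `k = ℚ`" is encoded on `ℂ`-points (`x ⊗ 1 = Θ x` fixed by every `γ ∈ S(H)(ℂ)`, resp.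
`Hg(H)(ℂ)`), as in g25-#6 and in the tree's Thm. 7.2.4. Milne's `L(A)`-invariants of `H^{2s}(A^r)(s)` are the
`S(A) = Ker l(A)`-invariants of `H^{2s}(A^r)` (the `𝔾_m`-factor acts on the Tate twist); only `S(A)` appears here. The tree's
`Hg` is DEFINED as the stabiliser of the Hodge tensors, so "`H^{2*}(A)^{Hg(A)} = H(A)`" is the tree's Thm. 7.2.4
(`…ExteriorPowerHodgeGroup`), restated in §1 in the `Θ`-language. Prop. 4.8 is proved in the direction (c) ⟹ (a) for
`A` itself (`r = 1`); (a) ⟹ (b)/(c) needs "the largest algebraic subgroup fixing the Lefschetz classes is `L(A)`"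
(Thm. 4.4, via Deligne 1982, 3.1 (c)), i.e. the algebraic-group structure of `S(H)`, which the point-group encoding does not
carry — NOT here; powers `A^r` (g25-#4/#7's diagonal action) — NOT here. Odd weight wherever `D_ℚ` or g25-#6 enters
(`Q` alternating, as for `H¹` of an abelian variety); §1's "S-invariant ⟹ Hodge" and §2's existence of `a` hold in every weight.

## References
* [Milne1999LefschetzClasses] J. S. Milne, *Lefschetz classes on abelian varieties*, Duke Math. J. 96 (1999), §4 Cor. 4.5
  (p. 659), p. 660 "Lefschetz classes and Hodge classes", Prop. 4.8, p. 661 L1–L2; §3 Thm. 3.2 (p. 653); §1 Prop. 1.3.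
* [MumfordAV1970] D. Mumford, *Abelian varieties* (1970), §21 Application III p. 208.
* [Lange2023AbelianVarietiesComplex] H. Lange, *Abelian Varieties over the Complex Numbers* (2023), §7.2.2 Thm. 7.2.4, §7.3.1.
* [DeligneHodgeII1971] P. Deligne, *Théorie de Hodge II*, Publ. Math. IHÉS 40 (1971), 2.1.15 (morphisms `H ⊗ H → ℚ(-n)`).
* [BourbakiAlgebre1a3] N. Bourbaki, *Algèbre* Ch. III §7 no. 2, no. 5 Prop. 8 (functoriality and base change of `⋀`).
-/

open scoped TensorProduct

namespace Literature.AlgebraicGeometry.Motives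

/-! ### §0 Bridge: `Θ = toComplexAlg` on `⋀ᵏ` versus the canonical base change `θ₀` -/

namespace ExteriorLefschetz

open ExteriorAlgebra

universe u

variable {V : Type u} [AddCommGroup V] [Module ℚ V]

/-- `θ₀(1 ⊗ x) = Θ x` in `⋀_ℂ V_ℂ` for `x ∈ ⋀ᵏ_ℚ V` (`θ₀ = exteriorPowerBaseChangeEquiv`, p02's
`coe_exteriorPowerBaseChange_one_tmul`). [cite: BourbakiAlgebre1a3, Ch. III §7 no. 5 Prop. 8] -/
theorem coe_exteriorPowerBaseChangeEquiv_ofRat {k : ℕ} (x : ⋀[ℚ]^k V) :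
    ((exteriorPowerBaseChangeEquiv V k (HodgeStructure.ofRat x) : ⋀[ℂ]^k (ℂ ⊗[ℚ] V)) :
        ExteriorAlgebra ℂ (ℂ ⊗[ℚ] V)) = toComplexAlg V (x : ExteriorAlgebra ℚ V) := by
  rw [exteriorPowerBaseChangeEquiv_apply, HodgeStructure.ofRat_apply, coe_exteriorPowerBaseChange_one_tmul]

/-- **`⋀ᵏ(f)(θ₀(1 ⊗ x)) = ⋀(f)(Θ x)` in `⋀_ℂ V_ℂ`**: Mathlib's `exteriorPower.map` on the canonical base change of a rational
`k`-vector is the algebra map `ExteriorAlgebra.map` on its complexification `Θ x = x ⊗ 1`.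
[cite: BourbakiAlgebre1a3, Ch. III §7 no. 2 and no. 5 Prop. 8] -/
theorem coe_exteriorPower_map_exteriorPowerBaseChangeEquiv_ofRat {k : ℕ} (f : ℂ ⊗[ℚ] V →ₗ[ℂ] ℂ ⊗[ℚ] V)
    (x : ⋀[ℚ]^k V) :
    ((exteriorPower.map k f (exteriorPowerBaseChangeEquiv V k (HodgeStructure.ofRat x)) : ⋀[ℂ]^k (ℂ ⊗[ℚ] V)) :
        ExteriorAlgebra ℂ (ℂ ⊗[ℚ] V)) = ExteriorAlgebra.map f (toComplexAlg V (x : ExteriorAlgebra ℚ V)) := by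
  rw [coe_exteriorPower_map, coe_exteriorPowerBaseChangeEquiv_ofRat]

/-- **Fixed in `⋀ᵏ_ℂ V_ℂ` iff fixed in `⋀_ℂ V_ℂ`**: `⋀ᵏ(f)(θ₀(1 ⊗ x)) = θ₀(1 ⊗ x)` iff `⋀(f)(Θ x) = Θ x` — the dictionary
between the tree's Thm. 7.2.4 (`exteriorPower.map`, `θ₀`) and the seat's Milne-§3 files (`ExteriorAlgebra.map`, `Θ`).
[cite: BourbakiAlgebre1a3, Ch. III §7 no. 2 and no. 5 Prop. 8] -/
theorem exteriorPower_map_exteriorPowerBaseChangeEquiv_ofRat_eq_iff {k : ℕ} (f : ℂ ⊗[ℚ] V →ₗ[ℂ] ℂ ⊗[ℚ] V)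
    (x : ⋀[ℚ]^k V) :
    exteriorPower.map k f (exteriorPowerBaseChangeEquiv V k (HodgeStructure.ofRat x)) =
        exteriorPowerBaseChangeEquiv V k (HodgeStructure.ofRat x) ↔
      ExteriorAlgebra.map f (toComplexAlg V (x : ExteriorAlgebra ℚ V)) = toComplexAlg V (x : ExteriorAlgebra ℚ V) := by
  rw [← Subtype.coe_inj, coe_exteriorPower_map_exteriorPowerBaseChangeEquiv_ofRat, coe_exteriorPowerBaseChangeEquiv_ofRat]

/-- **The skew form of `Θ y` read through `B_ℂ` is the base change of the skew form of `y` read through `B`**, pointwise: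
`B_{Θ y}(B_ℂ(x, ·), B_ℂ(z, ·)) = (ψ_y)_ℂ(x, z)`, `ψ_y(v, w) = B_y(B(v, ·), B(w, ·))` (g25-#6
`compl₁₂_contractionForm_toComplexAlg_baseChange`, unfolded). [cite: BourbakiAlgebre1a3, Ch. III §7 no. 5 Prop. 8 and §11 no. 9] -/
theorem contractionForm_toComplexAlg_baseChange_baseChange (B : LinearMap.BilinForm ℚ V) {y : ExteriorAlgebra ℚ V}
    (hy : y ∈ ⋀[ℚ]^2 V) (x z : ℂ ⊗[ℚ] V) :
    contractionForm (toComplexAlg V y) (B.baseChange ℂ x) (B.baseChange ℂ z) =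
      LinearMap.BilinForm.baseChange ℂ ((contractionForm y).compl₁₂ B B) x z := by
  have h := LinearMap.congr_fun₂ (compl₁₂_contractionForm_toComplexAlg_baseChange V B hy) x z
  rwa [LinearMap.compl₁₂_apply] at h

end ExteriorLefschetz

namespace HodgeStructure

open ExteriorLefschetz ExteriorAlgebra

universe u

/-! ### §1 "`H^{2*}(A)^{Hg(A)} = H(A)`" and "`D(A) ⊂ H(A)`" -/

section HodgeGroup

variable {V : Type u} [AddCommGroup V] [Module ℚ V] [Module.Finite ℚ V] [HodgeTensorFacts.{u, u}] {n : ℤ}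

/-- **"`H^{2*}(A^r)(*)^{Hg(A)} = H(A^r)`" (Deligne 1982, proof of Prop. 3.4) on the carrier, in the `Θ`-language**: for
`p + p = k n`, a rational class `x ∈ ⋀ᵏ_ℚ V` is a Hodge class of `⋀ᵏ H` of type `(p, p)` iff its complexification
`Θ x = x ⊗ 1 ∈ ⋀_ℂ V_ℂ` is fixed by `⋀(γ)` for every `γ ∈ Hg(H)(ℂ)` — the tree's Thm. 7.2.4
`mem_hodgeClasses_exteriorPower_iff_forall_hodgeGroupBaseChange` (for the canonical `θ₀`) through the §0 bridge.
[cite: Milne1999LefschetzClasses, §4 p. 660 L23–L26] [cite: Lange2023AbelianVarietiesComplex, §7.2.2 Thm. 7.2.4] -/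
theorem mem_hodgeClasses_exteriorPower_iff_forall_hodgeGroupBaseChange_map_toComplexAlg_eq (H : HodgeStructure V n)
    {k : ℕ} {p : ℤ} (hp : p + p = k * n) (x : ⋀[ℚ]^k V) :
    x ∈ (H.exteriorPower k).hodgeClasses p ↔ ∀ γ ∈ H.hodgeGroupBaseChange ℂ,
      ExteriorAlgebra.map (γ : ℂ ⊗[ℚ] V →ₗ[ℂ] ℂ ⊗[ℚ] V) (toComplexAlg V (x : ExteriorAlgebra ℚ V)) =
        toComplexAlg V (x : ExteriorAlgebra ℚ V) := by
  rw [mem_hodgeClasses_exteriorPower_iff_forall_hodgeGroupBaseChange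
    (Motives.isExteriorPowerBaseChange_exteriorPowerBaseChangeEquiv (V := V) (k := k)) H hp x]
  exact forall₂_congr fun γ _ ↦
    exteriorPower_map_exteriorPowerBaseChangeEquiv_ofRat_eq_iff (γ : ℂ ⊗[ℚ] V →ₗ[ℂ] ℂ ⊗[ℚ] V) x

variable {H : HodgeStructure V n} (Q : Polarization H)

/-- **"Clearly `D_hom(A) ⊂ H(A)`, and so `L(A) ⊃ Hg(A)`" read backwards: an `S(A)`-invariant class is a Hodge class.** For
`p + p = k n` and a rational class `x ∈ ⋀ᵏ_ℚ V`: if `Θ x` is fixed by every `γ ∈ S(H)(ℂ)`, then — since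
`Hg(H)(ℂ) ≤ S(H)(ℂ)` (g18-#1 `hodgeGroupBaseChange_le_lefschetzGroupBaseChange`) — it is fixed by `Hg(H)(ℂ)`, so `x` is a
Hodge class of type `(p, p)`. Any weight, any polarization. [cite: Milne1999LefschetzClasses, §4 p. 660 L33–L35 and Cor. 4.5 (p. 659)] -/
theorem Polarization.mem_hodgeClasses_of_forall_lefschetzGroupBaseChange_map_toComplexAlg_eq {k : ℕ} {p : ℤ}
    (hp : p + p = k * n) {x : ⋀[ℚ]^k V}
    (hx : ∀ γ ∈ Q.lefschetzGroupBaseChange ℂ,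
      ExteriorAlgebra.map (γ : ℂ ⊗[ℚ] V →ₗ[ℂ] ℂ ⊗[ℚ] V) (toComplexAlg V (x : ExteriorAlgebra ℚ V)) =
        toComplexAlg V (x : ExteriorAlgebra ℚ V)) :
    x ∈ (H.exteriorPower k).hodgeClasses p :=
  (H.mem_hodgeClasses_exteriorPower_iff_forall_hodgeGroupBaseChange_map_toComplexAlg_eq hp x).2 fun γ hγ ↦
    hx γ (Q.hodgeGroupBaseChange_le_lefschetzGroupBaseChange ℂ hγ)

/-- The set form of "an `S(A)`-invariant class is a Hodge class": inside `⋀_ℚ V`, the degree-`k` rational classes whose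
complexification is `S(H)(ℂ)`-invariant lie in (the image of) the Hodge classes `Hdgᵖ(⋀ᵏ H)`, `p + p = k n`.
[cite: Milne1999LefschetzClasses, §4 p. 660 L33–L35 and Cor. 4.5 (p. 659)] -/
theorem Polarization.setOf_mem_and_forall_lefschetzGroupBaseChange_map_toComplexAlg_eq_subset_map_hodgeClasses {k : ℕ}
    {p : ℤ} (hp : p + p = k * n) :
    {x : ExteriorAlgebra ℚ V | x ∈ ⋀[ℚ]^k V ∧ ∀ γ ∈ Q.lefschetzGroupBaseChange ℂ,
        ExteriorAlgebra.map (γ : ℂ ⊗[ℚ] V →ₗ[ℂ] ℂ ⊗[ℚ] V) (toComplexAlg V x) = toComplexAlg V x} ⊆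
      ↑(((H.exteriorPower k).hodgeClasses p).map (⋀[ℚ]^k V).subtype) := fun x hx ↦
  ⟨⟨x, hx.1⟩, Q.mem_hodgeClasses_of_forall_lefschetzGroupBaseChange_map_toComplexAlg_eq hp hx.2, rfl⟩

/-- **"`D(A) ⊂ H(A)`" for the `ℚ`-algebra generated by the divisor classes**: `(span_ℚ D_ℚ)ᵖ ⊆ Bᵖ = Hdg^{pn}(⋀^{2p} H)`
inside `⋀_ℚ V` (odd weight) — a `p`-fold product of rational divisor `2`-vectors has `S(H)(ℂ)`-invariant complexification
(g25-#6 `forall_lefschetzGroupBaseChange_map_toComplexAlg_eq_of_mem_span_pow`), hence is a Hodge class.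
[cite: Milne1999LefschetzClasses, §4 p. 660 L33–L35] [cite: MumfordAV1970, §21 Application III p. 208] -/
theorem Polarization.span_divisorTwoVectors_pow_le_map_hodgeClasses (hn : Odd n) (p : ℕ) :
    Submodule.span ℚ {y : ExteriorAlgebra ℚ V | y ∈ ⋀[ℚ]^2 V ∧ ∃ a ∈ H.endAlg, Q.adjoint a = a ∧
        ∀ v w, contractionForm y (Q.form v) (Q.form w) = Q.form (a v) w} ^ p ≤
      ((H.exteriorPower (2 * p)).hodgeClasses (p * n)).map (⋀[ℚ]^(2 * p) V).subtype := fun _ hx ↦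
  Q.setOf_mem_and_forall_lefschetzGroupBaseChange_map_toComplexAlg_eq_subset_map_hodgeClasses (by push_cast; ring)
    ⟨span_pow_le_exteriorPower (fun _ hy ↦ hy.1) p hx,
      Q.forall_lefschetzGroupBaseChange_map_toComplexAlg_eq_of_mem_span_pow hn p hx⟩

end HodgeGroup

/-! ### §2 Lefschetz `(1,1)` on the carrier: the divisor `2`-vectors are the Hodge classes of `⋀² H` -/

section LefschetzOneOne

variable {V : Type u} [AddCommGroup V] [Module ℚ V] [Module.Finite ℚ V] {n : ℤ} {H : HodgeStructure V n}
  (Q : Polarization H)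

omit [Module.Finite ℚ V] in
/-- `B = Q(β ·, ·)` after complexification: `B_ℂ(x, z) = Q_ℂ(β_ℂ x, z)`. Private plumbing. [folklore] -/
private theorem Polarization.baseChange_eq_baseChange_form_baseChange {B : LinearMap.BilinForm ℚ V} {β : Module.End ℚ V}
    (hβ : ∀ v w, B v w = Q.form (β v) w) (x z : ℂ ⊗[ℚ] V) :
    B.baseChange ℂ x z = Q.form.baseChange ℂ (β.baseChange ℂ x) z := by
  induction x using TensorProduct.induction_on with
  | zero => simp only [map_zero, LinearMap.zero_apply]
  | tmul c v =>
    induction z using TensorProduct.induction_on with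
    | zero => simp only [map_zero]
    | tmul c' w => simp only [LinearMap.baseChange_tmul, LinearMap.BilinForm.baseChange_tmul, hβ]
    | add z z' hz hz' => simp only [map_add, hz, hz']
  | add x x' hx hx' => simp only [map_add, LinearMap.add_apply, hx, hx']

/-- **A Hodge class `y ∈ ⋀² H` of type `(n, n)` is a twist of the polarization by a Hodge endomorphism**: there is
`a ∈ E_φ` with `ψ_y = Q(a ·, ·)`, `ψ_y(v, w) = B_y(Q(v, ·), Q(w, ·))` — any weight. Proof ("conversely, these are precisely
the classes fixed by the two groups", with Prop. 1.3): `Θ y` is fixed by `Hg(H)(ℂ)` (§1), so the skew form `ψ_{Θ y} = (ψ_y)_ℂ`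
(g25-#6 `compl₁₂_contractionForm_toComplexAlg_baseChange`) is `Hg(H)(ℂ)`-invariant (g25-#3
`map_eq_iff_forall_contractionForm_apply`, `Hg(H)(ℂ)` preserving `Q_ℂ`); writing `ψ_y = Q(a ·, ·)` (g18-#2
`existsUnique_form_comp`), invariance under the isometries `γ ∈ Hg(H)(ℂ)` says `a_ℂ γ = γ a_ℂ` (g18-#8
`forall_apply_apply_iff_comp_eq_comp_of_isometry`), i.e. `a ∈ E_φ` (`mem_endAlg_iff_forall_hodgeGroupBaseChange`).
[cite: Milne1999LefschetzClasses, §4 Prop. 4.8 (proof, p. 660) and §1 Prop. 1.3 (p. 643)] [cite: MumfordAV1970, §21 Application III p. 208] -/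
theorem Polarization.exists_mem_endAlg_forall_contractionForm_apply_eq_of_mem_hodgeClasses {y : ⋀[ℚ]^2 V}
    (hy : y ∈ (H.exteriorPower 2).hodgeClasses n) :
    ∃ a ∈ H.endAlg, ∀ v w, contractionForm (y : ExteriorAlgebra ℚ V) (Q.form v) (Q.form w) = Q.form (a v) w := by
  haveI : HodgeTensorFacts.{u, u} := hodgeTensorFacts_holds.{u, u}
  obtain ⟨a, ha, -⟩ := Q.existsUnique_form_comp ((contractionForm (y : ExteriorAlgebra ℚ V)).compl₁₂ Q.form Q.form)
  refine ⟨a, ?_, fun v w ↦ by rw [← ha v w, LinearMap.compl₁₂_apply]⟩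
  rw [mem_endAlg_iff_forall_hodgeGroupBaseChange H a]
  intro γ hγ
  have hγQ : ∀ x z, Q.form.baseChange ℂ (γ x) (γ z) = Q.form.baseChange ℂ x z :=
    Q.baseChange_form_apply_apply_of_mem_hodgeGroupBaseChange ℂ hγ
  have hinv : ExteriorAlgebra.map (γ : ℂ ⊗[ℚ] V →ₗ[ℂ] ℂ ⊗[ℚ] V) (toComplexAlg V (y : ExteriorAlgebra ℚ V)) =
      toComplexAlg V (y : ExteriorAlgebra ℚ V) :=
    (H.mem_hodgeClasses_exteriorPower_iff_forall_hodgeGroupBaseChange_map_toComplexAlg_eq (k := 2) (p := n)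
      (by push_cast; ring) y).1 hy γ hγ
  refine (Q.forall_apply_apply_iff_comp_eq_comp_of_isometry ℂ
    (Q.baseChange_eq_baseChange_form_baseChange ha) hγQ).1 fun x z ↦ ?_
  have e := (map_eq_iff_forall_contractionForm_apply Q.nondegenerate_baseChange (toComplexAlg_mem V y.2) γ hγQ).1
    hinv x z
  rwa [contractionForm_toComplexAlg_baseChange_baseChange Q.form y.2,
    contractionForm_toComplexAlg_baseChange_baseChange Q.form y.2] at e

/-- **Conversely, a twist of the polarization by a Hodge endomorphism is a Hodge class** — any weight: if `ψ_y = Q(a ·, ·)`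
with `a ∈ E_φ` for `y ∈ ⋀²_ℚ V`, then `y ∈ B¹ = Hdgⁿ(⋀² H)`. Proof ("Clearly `D_hom(A) ⊂ H(A)`"): `(ψ_y)_ℂ = Q_ℂ(a_ℂ ·, ·)`
is invariant under `S(H)(ℂ)` (g18-#8 `forall_lefschetzGroupBaseChange_form_apply_apply_of_mem_span`: its elements commute
with `a_ℂ` and preserve `Q_ℂ`), so `Θ y` is fixed by `S(H)(ℂ)` (g25-#3 `map_eq_iff_forall_contractionForm_apply`), so `y` is
a Hodge class (§1). [cite: Milne1999LefschetzClasses, §4 p. 660 L33–L35 and §3 p. 653 L36–L40] [cite: MumfordAV1970, §21 Application III p. 208] -/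
theorem Polarization.mem_hodgeClasses_of_forall_contractionForm_apply_eq {y : ⋀[ℚ]^2 V} {a : Module.End ℚ V}
    (ha : a ∈ H.endAlg) (hya : ∀ v w, contractionForm (y : ExteriorAlgebra ℚ V) (Q.form v) (Q.form w) = Q.form (a v) w) :
    y ∈ (H.exteriorPower 2).hodgeClasses n := by
  haveI : HodgeTensorFacts.{u, u} := hodgeTensorFacts_holds.{u, u}
  refine Q.mem_hodgeClasses_of_forall_lefschetzGroupBaseChange_map_toComplexAlg_eq (by push_cast; ring) fun γ hγ ↦ ?_
  have hγQ : ∀ x z, Q.form.baseChange ℂ (γ x) (γ z) = Q.form.baseChange ℂ x z :=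
    Q.baseChange_form_apply_apply_of_mem_lefschetzGroupBaseChange hγ
  have hψa : ∀ v w, (contractionForm (y : ExteriorAlgebra ℚ V)).compl₁₂ Q.form Q.form v w = Q.form (a v) w :=
    fun v w ↦ by rw [LinearMap.compl₁₂_apply, hya]
  have hmem : a.baseChange ℂ ∈ Submodule.span ℂ (Set.range fun b : H.endAlg ↦ (b : Module.End ℚ V).baseChange ℂ) :=
    Submodule.subset_span ⟨⟨a, ha⟩, rfl⟩
  have hinv := Q.forall_lefschetzGroupBaseChange_form_apply_apply_of_mem_span ℂ
    (Q.baseChange_eq_baseChange_form_baseChange hψa) hmem γ hγ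
  refine (map_eq_iff_forall_contractionForm_apply Q.nondegenerate_baseChange (toComplexAlg_mem V y.2) γ hγQ).2
    fun x z ↦ ?_
  rw [contractionForm_toComplexAlg_baseChange_baseChange Q.form y.2,
    contractionForm_toComplexAlg_baseChange_baseChange Q.form y.2]
  exact hinv x z

/-- **The Hodge classes of `⋀² H` of type `(n, n)` are exactly the twists `Q(a ·, ·)`, `a ∈ E_φ`, read on `⋀² V`** — any
weight, any polarization: `y ∈ B¹` iff `ψ_y = Q(a ·, ·)` for some Hodge endomorphism `a` ("these are precisely the classes
fixed by the two groups" composed with Prop. 1.3 "exactly the `k`-linear combinations of forms `e_D`").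
[cite: Milne1999LefschetzClasses, §4 Prop. 4.8 (proof, p. 660) and §1 Prop. 1.3 (p. 643)] -/
theorem Polarization.mem_hodgeClasses_two_iff_exists_mem_endAlg (y : ⋀[ℚ]^2 V) :
    y ∈ (H.exteriorPower 2).hodgeClasses n ↔
      ∃ a ∈ H.endAlg, ∀ v w, contractionForm (y : ExteriorAlgebra ℚ V) (Q.form v) (Q.form w) = Q.form (a v) w :=
  ⟨fun hy ↦ Q.exists_mem_endAlg_forall_contractionForm_apply_eq_of_mem_hodgeClasses hy,
    fun ⟨_, ha, hya⟩ ↦ Q.mem_hodgeClasses_of_forall_contractionForm_apply_eq ha hya⟩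

/-- **"If `ψ` is skew-symmetric, then `β = β†`"** for the skew form of a `2`-vector (odd weight): if `ψ_y = Q(a ·, ·)` for
some `y ∈ ⋀_ℚ V`, then `a† = a` — `ψ_y` is alternating (`contractionForm_isAlt`) and `Q` has parity `(-1)ⁿ = -1` (g18-#2
`forall_form_swap_iff_adjoint_eq_self`). [cite: Milne1999LefschetzClasses, §1 Prop. 1.3 (proof, p. 643)] [cite: MumfordAV1970, §21 Application III p. 208] -/
theorem Polarization.adjoint_eq_self_of_forall_contractionForm_apply_eq (hn : Odd n) {y : ExteriorAlgebra ℚ V}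
    {a : Module.End ℚ V} (hya : ∀ v w, contractionForm y (Q.form v) (Q.form w) = Q.form (a v) w) :
    Q.adjoint a = a := by
  have ha : ∀ v w, (contractionForm y).compl₁₂ Q.form Q.form v w = Q.form (a v) w := fun v w ↦ by
    rw [LinearMap.compl₁₂_apply, hya]
  refine (Q.forall_form_swap_iff_adjoint_eq_self ha).1 fun v w ↦ ?_
  rw [Int.negOnePow_odd n hn, Units.val_neg, Units.val_one, Int.cast_neg, Int.cast_one, neg_one_mul,
    LinearMap.compl₁₂_apply, LinearMap.compl₁₂_apply]
  exact ((contractionForm_isAlt y).neg_eq (Q.form v) (Q.form w)).symm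

/-- **Lefschetz `(1,1)` on the carrier: the Hodge classes of `⋀² H` of type `(n, n)` are exactly the divisor `2`-vectors**
(odd weight): for `y ∈ ⋀²_ℚ V`, `y ∈ B¹ = Hdgⁿ(⋀² H)` iff `ψ_y = Q(a ·, ·)` for some `a ∈ E_φ` with `a† = a` —
"`NS(A) ⊗ ℚ = {a ∈ End⁰(A) | a† = a}`" composed with "`H²(A, ℚ) ∩ H^{1,1} = NS(A) ⊗ ℚ`" for `H = H¹(A, ℚ)` (the symmetry
`a† = a` is automatic, `adjoint_eq_self_of_forall_contractionForm_apply_eq`).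
[cite: Milne1999LefschetzClasses, §4 p. 660 L33–L35 and Prop. 4.8 (proof)] [cite: MumfordAV1970, §21 Application III p. 208] -/
theorem Polarization.mem_hodgeClasses_two_iff_exists_mem_endAlg_adjoint_eq_self (hn : Odd n) (y : ⋀[ℚ]^2 V) :
    y ∈ (H.exteriorPower 2).hodgeClasses n ↔ ∃ a ∈ H.endAlg, Q.adjoint a = a ∧
      ∀ v w, contractionForm (y : ExteriorAlgebra ℚ V) (Q.form v) (Q.form w) = Q.form (a v) w := by
  rw [Q.mem_hodgeClasses_two_iff_exists_mem_endAlg y]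
  exact ⟨fun ⟨a, ha, hya⟩ ↦ ⟨a, ha, Q.adjoint_eq_self_of_forall_contractionForm_apply_eq hn hya, hya⟩,
    fun ⟨a, ha, _, hya⟩ ↦ ⟨a, ha, hya⟩⟩

section AsMorphism

variable [HodgeTensorFacts.{u, u}]

/-- **A `2`-vector is a Hodge class iff its skew form is a morphism of Hodge structures `H ⊗ H → ℚ(-n)`** — any weight:
`y ∈ Hdgⁿ(⋀² H)` iff `v ⊗ w ↦ ψ_y(v, w)` underlies a morphism `H ⊗ H → ℚ(-n)` (the tree's `Hom`, `tensor`, `tate`), through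
g18-#2's six readings of a divisor-type `2`-form (`forall_centralizer_form_apply_adjoint_tfae`: `∃ β ∈ E_φ, B = Q(β ·, ·)`
iff `B` underlies such a morphism). For `H = H¹(A, ℚ)`: a class in `H²(A, ℚ) = ⋀² H¹` is of type `(1,1)` iff the
corresponding class in `H¹ ⊗ H¹` is. [cite: Milne1999LefschetzClasses, §1 Prop. 1.3, Remark 1.4 and §4 p. 660]
[cite: DeligneHodgeII1971, 2.1.15] -/
theorem Polarization.mem_hodgeClasses_two_iff_exists_hom (y : ⋀[ℚ]^2 V) :
    y ∈ (H.exteriorPower 2).hodgeClasses n ↔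
      ∃ f : Hom (H.tensor H) ((HodgeStructure.tate (-n)).cast (tate_neg_weight n)),
        f.toLinearMap = TensorProduct.lift ((contractionForm (y : ExteriorAlgebra ℚ V)).compl₁₂ Q.form Q.form) := by
  have h := (Q.forall_centralizer_form_apply_adjoint_tfae
    ((contractionForm (y : ExteriorAlgebra ℚ V)).compl₁₂ Q.form Q.form)).out 1 5
  simp only [LinearMap.compl₁₂_apply] at h
  rw [Q.mem_hodgeClasses_two_iff_exists_mem_endAlg y]
  exact h

/-- The same through the Hodge group on RATIONAL points and Milne's centraliser: `y ∈ Hdgⁿ(⋀² H)` iff `ψ_y` is invariant under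
`Hg(H)(ℚ)`, iff `ψ_y(c v, w) = ψ_y(v, c† w)` for every `c` in Milne's centraliser `C(H)` of `E_φ` (g18-#2's readings (3) and
(1)). [cite: Milne1999LefschetzClasses, §1 Prop. 1.3, (1.2), Remark 1.4 and §4 p. 660] -/
theorem Polarization.mem_hodgeClasses_two_iff_forall_hodgeGroup (y : ⋀[ℚ]^2 V) :
    y ∈ (H.exteriorPower 2).hodgeClasses n ↔ ∀ g ∈ H.hodgeGroup, ∀ v w,
      contractionForm (y : ExteriorAlgebra ℚ V) (Q.form (g v)) (Q.form (g w)) =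
        contractionForm (y : ExteriorAlgebra ℚ V) (Q.form v) (Q.form w) := by
  have h := (Q.forall_centralizer_form_apply_adjoint_tfae
    ((contractionForm (y : ExteriorAlgebra ℚ V)).compl₁₂ Q.form Q.form)).out 1 2
  simp only [LinearMap.compl₁₂_apply] at h
  rw [Q.mem_hodgeClasses_two_iff_exists_mem_endAlg y]
  exact h

end AsMorphism

/-- **`D_ℚ = B¹` inside `⋀_ℚ V`**: the set of rational divisor `2`-vectors of g25-#6 IS (the image of) the `ℚ`-subspace of
Hodge classes of `⋀² H` of type `(n, n)` (odd weight). [cite: Milne1999LefschetzClasses, §4 p. 660 L33–L35]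
[cite: MumfordAV1970, §21 Application III p. 208] -/
theorem Polarization.divisorTwoVectors_eq_image_hodgeClasses (hn : Odd n) :
    {y : ExteriorAlgebra ℚ V | y ∈ ⋀[ℚ]^2 V ∧ ∃ a ∈ H.endAlg, Q.adjoint a = a ∧
        ∀ v w, contractionForm y (Q.form v) (Q.form w) = Q.form (a v) w} =
      ↑(((H.exteriorPower 2).hodgeClasses n).map (⋀[ℚ]^2 V).subtype) := by
  ext y
  constructor
  · rintro ⟨hy2, hrest⟩
    exact ⟨⟨y, hy2⟩, (Q.mem_hodgeClasses_two_iff_exists_mem_endAlg_adjoint_eq_self hn ⟨y, hy2⟩).2 hrest, rfl⟩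
  · rintro ⟨y', hy', rfl⟩
    exact ⟨y'.2, (Q.mem_hodgeClasses_two_iff_exists_mem_endAlg_adjoint_eq_self hn y').1 hy'⟩

/-- `span_ℚ D_ℚ = B¹` inside `⋀_ℚ V`: the rational divisor `2`-vectors already form the `ℚ`-subspace of degree-two Hodge
classes of type `(n, n)` (odd weight). [cite: Milne1999LefschetzClasses, §4 p. 660 L33–L35] [cite: MumfordAV1970, §21 Application III p. 208] -/
theorem Polarization.span_divisorTwoVectors_eq_map_hodgeClasses (hn : Odd n) :
    Submodule.span ℚ {y : ExteriorAlgebra ℚ V | y ∈ ⋀[ℚ]^2 V ∧ ∃ a ∈ H.endAlg, Q.adjoint a = a ∧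
        ∀ v w, contractionForm y (Q.form v) (Q.form w) = Q.form (a v) w} =
      ((H.exteriorPower 2).hodgeClasses n).map (⋀[ℚ]^2 V).subtype := by
  rw [Q.divisorTwoVectors_eq_image_hodgeClasses hn, Submodule.span_eq]

/-! ### §3 Milne's `D(A)` (the `ℚ`-algebra generated by the divisor classes) is Lange's `D•` -/

/-- **`(span_ℚ D_ℚ)ᵖ = Dᵖ` inside `⋀_ℚ V`** (odd weight): the degree-`2p` part of the `ℚ`-subalgebra generated by the
rational divisor `2`-vectors is p29's `H.divisorClasses p` (`D⁰ = ⋀⁰`, `D^{p+1} = Dᵖ ∧ B¹`; `map_subtype_divisorClasses`: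
`Dᵖ = (B¹)ᵖ`). [cite: Milne1999LefschetzClasses, §4 Cor. 4.5 (p. 659) and p. 660 L30–L33]
[cite: Lange2023AbelianVarietiesComplex, §7.3.1] -/
theorem Polarization.span_divisorTwoVectors_pow_eq_map_divisorClasses (hn : Odd n) (p : ℕ) :
    Submodule.span ℚ {y : ExteriorAlgebra ℚ V | y ∈ ⋀[ℚ]^2 V ∧ ∃ a ∈ H.endAlg, Q.adjoint a = a ∧
        ∀ v w, contractionForm y (Q.form v) (Q.form w) = Q.form (a v) w} ^ p =
      (H.divisorClasses p).map (⋀[ℚ]^(2 * p) V).subtype := by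
  rw [Q.span_divisorTwoVectors_eq_map_hodgeClasses hn, map_subtype_divisorClasses]

/-! ### §4 Corollary 4.5 on the carrier: `H^{2p}(A, ℚ)^{S(A)} = Dᵖ(A)` -/

/-- **Milne 1999, Cor. 4.5 on the carrier (`r = 1`, `k = ℚ`)**: for a polarized `ℚ`-Hodge structure of odd weight and a
rational class `x ∈ ⋀^{2p}_ℚ V`, the complexification `Θ x = x ⊗ 1` is fixed by every `γ ∈ S(H)(ℂ)` iff `x` is a divisor
class, `x ∈ Dᵖ` ("`H^{2*}(A^r)(*)^{L(A)} = D_hom(A^r)_k`", `Ker l(A) = S(A)`) — g25-#6's Thm. 3.2 with rational coefficients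
composed with §3. [cite: Milne1999LefschetzClasses, §4 Cor. 4.5 (p. 659) and p. 659 L28–L30] [cite: Lange2023AbelianVarietiesComplex, §7.3.1] -/
theorem Polarization.forall_lefschetzGroupBaseChange_map_toComplexAlg_eq_iff_mem_divisorClasses (hn : Odd n) {p : ℕ}
    (x : ⋀[ℚ]^(2 * p) V) :
    (∀ γ ∈ Q.lefschetzGroupBaseChange ℂ,
        ExteriorAlgebra.map (γ : ℂ ⊗[ℚ] V →ₗ[ℂ] ℂ ⊗[ℚ] V) (toComplexAlg V (x : ExteriorAlgebra ℚ V)) =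
          toComplexAlg V (x : ExteriorAlgebra ℚ V)) ↔ x ∈ H.divisorClasses p := by
  constructor
  · intro hx
    have h := Q.mem_span_divisorTwoVectors_pow_of_forall_lefschetzGroupBaseChange_map_toComplexAlg_eq hn x.2 hx
    rw [Q.span_divisorTwoVectors_pow_eq_map_divisorClasses hn p] at h
    obtain ⟨x', hx', hxx'⟩ := h
    rwa [← Subtype.ext hxx']
  · intro hx
    have h : (x : ExteriorAlgebra ℚ V) ∈ (H.divisorClasses p).map (⋀[ℚ]^(2 * p) V).subtype := ⟨x, hx, rfl⟩
    rw [← Q.span_divisorTwoVectors_pow_eq_map_divisorClasses hn p] at h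
    exact Q.forall_lefschetzGroupBaseChange_map_toComplexAlg_eq_of_mem_span_pow hn p h

/-- **"`H^{2p}(A, ℚ)^{S(A)} = Dᵖ(A)`" as subsets of `⋀_ℚ V`**: the rational `2p`-vectors with `S(H)(ℂ)`-invariant
complexification are exactly (the image of) `Dᵖ = H.divisorClasses p`. [cite: Milne1999LefschetzClasses, §4 Cor. 4.5 (p. 659)]
[cite: Lange2023AbelianVarietiesComplex, §7.3.1] -/
theorem Polarization.setOf_mem_and_forall_lefschetzGroupBaseChange_map_toComplexAlg_eq_eq_map_divisorClasses (hn : Odd n)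
    (p : ℕ) :
    {x : ExteriorAlgebra ℚ V | x ∈ ⋀[ℚ]^(2 * p) V ∧ ∀ γ ∈ Q.lefschetzGroupBaseChange ℂ,
        ExteriorAlgebra.map (γ : ℂ ⊗[ℚ] V →ₗ[ℂ] ℂ ⊗[ℚ] V) (toComplexAlg V x) = toComplexAlg V x} =
      ↑((H.divisorClasses p).map (⋀[ℚ]^(2 * p) V).subtype) := by
  rw [Q.setOf_mem_and_forall_lefschetzGroupBaseChange_map_toComplexAlg_eq_eq_span_pow hn p,
    Q.span_divisorTwoVectors_pow_eq_map_divisorClasses hn p]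

/-- **"`H^{2*}(A, ℚ)^{S(A)}` is the `ℚ`-algebra generated by `H²_Hodge`"**: the rational classes (homogeneous or not) whose
complexification is `S(H)(ℂ)`-invariant form exactly the `ℚ`-subalgebra of `⋀_ℚ V` generated by the degree-two Hodge classes
`B¹` (`= ⨁_p Dᵖ`, Lange's `D•`). [cite: Milne1999LefschetzClasses, §3 Thm. 3.2 (p. 653) and §4 Cor. 4.5 (p. 659)]
[cite: Lange2023AbelianVarietiesComplex, §7.3.1] -/
theorem Polarization.setOf_forall_lefschetzGroupBaseChange_map_toComplexAlg_eq_eq_adjoin_hodgeClasses_two (hn : Odd n) :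
    {x : ExteriorAlgebra ℚ V | ∀ γ ∈ Q.lefschetzGroupBaseChange ℂ,
        ExteriorAlgebra.map (γ : ℂ ⊗[ℚ] V →ₗ[ℂ] ℂ ⊗[ℚ] V) (toComplexAlg V x) = toComplexAlg V x} =
      ↑(Algebra.adjoin ℚ (((H.exteriorPower 2).hodgeClasses n).map (⋀[ℚ]^2 V).subtype :
        Set (ExteriorAlgebra ℚ V))) := by
  rw [Q.setOf_forall_lefschetzGroupBaseChange_map_toComplexAlg_eq_eq_adjoin hn, Q.divisorTwoVectors_eq_image_hodgeClasses hn]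

/-- **Exotic classes** ("a Hodge class not in `D_hom(A)`"; "the class `c` is fixed by the identity component of `S(A)` but
not by `S(A)` itself"): a Hodge class `x ∈ Bᵖ` of `⋀^{2p} H` is exotic, `x ∉ Dᵖ`, iff some `γ ∈ S(H)(ℂ)` moves its
complexification. [cite: Milne1999LefschetzClasses, §4 p. 660 L35–L36 and p. 661 L1–L2] -/
theorem Polarization.not_mem_divisorClasses_iff_exists_lefschetzGroupBaseChange (hn : Odd n) {p : ℕ}
    (x : ⋀[ℚ]^(2 * p) V) :
    x ∉ H.divisorClasses p ↔ ∃ γ ∈ Q.lefschetzGroupBaseChange ℂ,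
      ExteriorAlgebra.map (γ : ℂ ⊗[ℚ] V →ₗ[ℂ] ℂ ⊗[ℚ] V) (toComplexAlg V (x : ExteriorAlgebra ℚ V)) ≠
        toComplexAlg V (x : ExteriorAlgebra ℚ V) := by
  rw [← Q.forall_lefschetzGroupBaseChange_map_toComplexAlg_eq_iff_mem_divisorClasses hn x]
  push Not
  rfl

/-! ### §5 Proposition 4.8 (c) ⟹ (a) for `A` itself: `Hg′(A) = S(A)` forces `Dᵖ = Bᵖ` -/

end LefschetzOneOne

section NoExotic

variable {V : Type u} [AddCommGroup V] [Module ℚ V] [Module.Finite ℚ V] [HodgeTensorFacts.{u, u}] {n : ℤ}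
  {H : HodgeStructure V n} (Q : Polarization H)

/-- **Prop. 4.8, (c) ⟹ (a) for `A` itself: if `Hg(H)(ℂ) = S(H)(ℂ)` then `A` supports no exotic Hodge class** — `Dᵖ = Bᵖ`
(`= Hdg^{pn}(⋀^{2p} H)`) for every `p` (odd weight): a Hodge class is `Hg(H)(ℂ)`-invariant (§1), hence `S(H)(ℂ)`-invariant,
hence a divisor class (Cor. 4.5). [cite: Milne1999LefschetzClasses, §4 Prop. 4.8 (p. 660)] -/
theorem Polarization.divisorClasses_eq_hodgeClasses_of_hodgeGroupBaseChange_eq (hn : Odd n)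
    (hHg : H.hodgeGroupBaseChange ℂ = Q.lefschetzGroupBaseChange ℂ) (p : ℕ) :
    H.divisorClasses p = (H.exteriorPower (2 * p)).hodgeClasses (p * n) := by
  refine le_antisymm (H.divisorClasses_le_hodgeClasses p) fun x hx ↦ ?_
  rw [← Q.forall_lefschetzGroupBaseChange_map_toComplexAlg_eq_iff_mem_divisorClasses hn x, ← hHg]
  exact (H.mem_hodgeClasses_exteriorPower_iff_forall_hodgeGroupBaseChange_map_toComplexAlg_eq (by push_cast; ring) x).1 hx

omit [HodgeTensorFacts.{u, u}] in
/-- **Prop. 4.8, (a) ⟹ "the Hodge classes are fixed by `S(A)`", on `A` itself**: if `Dᵖ = Bᵖ` for every `p` (no exotic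
Hodge class on `A`), then every Hodge class of `⋀^{2p} H` has `S(H)(ℂ)`-invariant complexification (odd weight) — the
pointwise content of "`Hg(A) = L(A)`" short of the algebraic-group statement. [cite: Milne1999LefschetzClasses, §4 Prop. 4.8 (proof, p. 660)] -/
theorem Polarization.forall_lefschetzGroupBaseChange_map_toComplexAlg_eq_of_forall_divisorClasses_eq (hn : Odd n)
    (hBD : ∀ p : ℕ, H.divisorClasses p = (H.exteriorPower (2 * p)).hodgeClasses (p * n)) {p : ℕ} {x : ⋀[ℚ]^(2 * p) V}
    (hx : x ∈ (H.exteriorPower (2 * p)).hodgeClasses (p * n)) :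
    ∀ γ ∈ Q.lefschetzGroupBaseChange ℂ,
      ExteriorAlgebra.map (γ : ℂ ⊗[ℚ] V →ₗ[ℂ] ℂ ⊗[ℚ] V) (toComplexAlg V (x : ExteriorAlgebra ℚ V)) =
        toComplexAlg V (x : ExteriorAlgebra ℚ V) :=
  (Q.forall_lefschetzGroupBaseChange_map_toComplexAlg_eq_iff_mem_divisorClasses hn x).2 ((hBD p).symm ▸ hx)

/-- **Weight one** (`H = H¹(A, ℚ)` of an abelian variety, `Bᵖ = Hdgᵖ(⋀^{2p} H¹)` the Hodge classes of codimension `p`):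
`Hg(H)(ℂ) = S(H)(ℂ)` ⟹ `Dᵖ(A) = Bᵖ(A)` for every `p` — no exotic Hodge classes on `A`.
[cite: Milne1999LefschetzClasses, §4 Prop. 4.8 (p. 660)] -/
theorem Polarization.divisorClasses_eq_hodgeClasses_weightOne_of_hodgeGroupBaseChange_eq {H : HodgeStructure V 1}
    (Q : Polarization H) (hHg : H.hodgeGroupBaseChange ℂ = Q.lefschetzGroupBaseChange ℂ) (p : ℕ) :
    H.divisorClasses p = (H.exteriorPower (2 * p)).hodgeClasses p := by
  simpa using Q.divisorClasses_eq_hodgeClasses_of_hodgeGroupBaseChange_eq odd_one hHg p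

end NoExotic

end HodgeStructure

end Literature.AlgebraicGeometry.Motives
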